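import Summits.RiemannHypothesis.RiemannHypothesis.Theorems.TiltedLandingLaw421R3RateGlue2A
import Summits.RiemannHypothesis.RiemannHypothesis.Theorems.TiltedLandingLaw421R3ColumnImmunity

/-! # Lens2_TouchedGlueSketch v3-OPTION — CAP-FREE GLUE SKETCH for (T″): `TouchedDissipationLawSQ → … → ApproachAllowanceQ (approachBudgetHalfQ riseSupQ consSupQ)`
CRUX WORKFILE (lens-2 g5; option for director-rh g25 after the Γ1 exposure «WΓ»); NOT an image, never to land as is.  **= v2 11c94e347a5bbc74 with (i) §0
extended by the statement file's §2b (T″ `TouchedDissipationLawSQ`, its ∃-form), (ii) ★ `betaClassLaw_of_TS` / ★★ `approachC_of_TS` REPLACING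
`betaClassLaw_of_T` / `approachC_of_T`: the same conclusions from T″ + Γ2 + Γ3 (+ Γ4 + FIT) with NO STATE CAP (Γ1 dropped from the hypotheses; its
`def` kept for reference), all other objects and lemmas byte-identical.**  §0 repeats `lens2/TouchedDissipation-v3opt.lean` §1–§2b VERBATIM (same
namespace; never imported together).  EVERYTHING BELOW IS PROVED (0 sorry); the remaining gaps are the NAMED, TYPED HYPOTHESES (Γ2)–(Γ4) + the CAPITAL FIT.
THE CHAIN.  Potential `Φ k := (1+θ)²η²/(c·s²) · E k`, `E k := lowH k² + touchH k²` (`touchH` = sup of the heights of the touchers of the lowest band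
states; an untouched level reads `lowH²`).  On a charged β-level (approach ∧ lowest state touched, atomic, above the floor κ₀):
(T″) `c·s² ≤ η²·(Im v² + Im z² − childEnergy(Ū))` [v2 obtained this from (T′) + the cap Γ1], (K) `Im v² + Im z² ≤ E k`, (Γ2 PERSISTENCE) `E (k+1) ≤ childEnergy(Ū)`
⟹ `Φ k − Φ (k+1) ≥ 1` (`sCurrency_of_dimensionless`) — the level is PAID by the potential; its signed height move `−4·dropQ/s` (covered levels may
rise, CE2-type) and every other move of `Φ` are BOOKED in the rise meter `touchRiseQ` with allowance `aT` (Γ3, shape of `EnergyRiseLawQ`); the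
socket `classLawQ_of_potential_rises` then gives ★ `betaClassLaw_of_T : ClassLawQ (BetaLevelQ κ₀) (betaPurseQ θ c + aT)` with
`betaPurseQ θ c = (1+θ)²(Hs/s)²/(2c)` (`Φ 0 ≤ (1+θ)²η²·2Hs²/(c s²)`, `2η ≤ 1`): c = 3 ⇒ `(1/6)(1+θ)²(Hs/s)² ≤ 0.17·(Hs/s)²` at θ ≤ 1/200
(`betaPurseQ_three_le`, the director's number (CA588)); c = 1 (admissible floor of `TouchedDissipationLawQEx`) ⇒ `≤ 0.51·(Hs/s)²` (`betaPurseQ_one_le`).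
The rest of the approach class (Γ4: class α = untouched approach levels — ride F1's step `ApproachChild` #1163 + a cap; sub-floor levels; non-atomic
clusters P ≥ 3) enters as ONE class law `ClassLawQ (approach ∖ β) aRest`; `classLawQ_union` reassembles ★A's class, and the LAST hypothesis is the
CAPITAL FIT per legal frame `betaPurseQ θ c + aT + aRest ≤ approachBudgetHalfQ riseSupQ consSupQ = slack0Q − (5/4)·energyPurseQ − (5/4)·riseSupQ −
consSupQ + (B+1)/2`, `slack0Q = (Hs/s)² + B + 1 + 4·hmax/s − (T₀⁺ + 4·lowH 0/s)` (`approachBudgetHalf_apply`) — i.e. the β purse is a share of the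
EXISTING `(Hs/s)²` term: NO new constant, NO registry v12 (★★ `approachC_of_T`, conclusion literally `stub_approachC`'s type).
HONEST GAPS, by name: (Γ1) STATE CAP on approach levels — near foreign zeros sit within R/2, so `κ_v ≤ (1+θ)η/s` is NOT the far-level cap of law #2;
the toucher's own contribution is self-normalising (`(1/d)²·E ≤ (Im v²+Im z²)/(Im v+Im z)² ≤ 1`), which suggests splitting κ_v = far + near and
paying the near part per near zero (the purse's `B`-terms) — instrument column wanted: κ_v·s/η on touched approach levels; (Γ2) PERSISTENCE — the next
level's pair energy is at most the children's energy in `Ū` (the lowest state at k+1 is a child in `Ū` or lower, and its tallest toucher is at most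
the taller child): false at lineage jumps / toucher swaps, which (Γ3) books as rises; (Γ3) RISE ALLOWANCE `aT` — phase starts (`+touchH²` when a
toucher appears), toucher swaps, lineage jumps, covered anti-drops; bounded only frame-wise (canonical sup), its SIZE is a capital question;
(Γ4) the REST of the approach class; (CAPITAL) the fit itself = the registry's ★A proper.  Plus the LAW's own gaps LOCALISATION / ORDER (statement
file header).  **v3-OPTION (for director-rh g25; v2 theorems kept byte-for-byte):** §0 also carries the `s`-currency law (T″) `TouchedDissipationLawSQ` of
`TouchedDissipation-v3opt.lean`, and §G4/§G5 add ★ `betaClassLaw_of_TS` / ★★ `approachC_of_TS`: the SAME conclusions from **T″ + Γ2 + Γ3 (+ Γ4 + FIT)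
WITHOUT the state cap Γ1** (which has the candidate negative «WΓ», κ_v·s/η = 1.0376 on a legal-looking charged approach β-level — see the statement file's
header); θ survives only as the rise meter's parameter (`0 ≤ θ`; θ = 0 admissible), the purse is `betaPurseQ θ c` as before.

Nothing here bears on the truth of RH; RH is NOT proved; (T) / ★A / 33346 / 33347 OPEN; checked ≠ landed ≠ proved. -/

namespace RhW08.TouchedDissipation

open Complex
open scoped ComplexConjugate
open RhW08.Round1 RhW08.StSwap RhW08.Round2 RhW08.QuadW
open RhW08.SealSwap (PBot)
open RhW08.SealSwapQ RhW08.RateSplit RhW08.BurgersRate RhW08.BurgersRateG3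
open RhIdea6.G17.W07C7 RhIdea6.G17.W07C7.Rev6 RhIdea6.G18.W07C8.Law421BirthS RhIdea6.G19.W07C11.Seam
open RhIdea6.G20.W07C12.Frac RhIdea6.G20.W07C12.StColP RhW07.C12.FieldSplit RhIdea6.G21.W07C13.TentMax
open RhW07.C14.TwoSided RhW07.C14.Classes RhW07.C14.Lineage RhW07.C14.Booking

/-! ## §0 = statement file `lens2/TouchedDissipation-v3opt.lean` §1–§2b, verbatim (§1–§2 = v2 = C′ of record) -/

/-! ## §1 Objects (expressions in `iteratedDeriv`; no structure, no instance) -/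

/-- §1 the TOUCH relation at level `j`: `z` is a zero of `f⁽ʲ⁾` STRICTLY TALLER than `v` whose closed axis-centred Jensen disc meets `v`'s —
`Im v < Im z ∧ |Re v − Re z| ≤ Im v + Im z` (the negation instance of R1a′'s separation binder C′ in `FarChildExistsLawSep`). -/
def Touches (f : ℂ → ℂ) (j : ℕ) (v z : ℂ) : Prop :=
  iteratedDeriv j f z = 0 ∧ v.im < z.im ∧ |v.re - z.re| ≤ v.im + z.im

/-- §1 the pair is ATOMIC at level `j`: every OTHER upper zero `u` of `f⁽ʲ⁾` is disc-separated from both `v` and `z`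
(`Im · + Im u < |Re · − Re u|`), i.e. the cluster of `v` is exactly `{v, z}` (W1's `P = 2`; lens-1's atomic two-pair class). -/
def AtomicPair (f : ℂ → ℂ) (j : ℕ) (v z : ℂ) : Prop :=
  ∀ u : ℂ, iteratedDeriv j f u = 0 → 0 < u.im → u ≠ v → u ≠ z → v.im + u.im < |v.re - u.re| ∧ z.im + u.im < |z.re - u.re|

/-- §1 the closed two-disc union `Ū = D̄_v ∪ D̄_z` of the axis-centred Jensen discs (`‖u − Re v‖ ≤ Im v` or `‖u − Re z‖ ≤ Im z`). -/
def pairUnion (v z : ℂ) : Set ℂ :=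
  {u : ℂ | ‖u - (v.re : ℂ)‖ ≤ v.im ∨ ‖u - (z.re : ℂ)‖ ≤ z.im}

/-- §1 the multiplicity-weighted ENERGY OF THE UPPER CHILDREN of `f⁽ʲ⁺¹⁾` off `Z(f⁽ʲ⁾)` inside a set `S`:
`Σᶠ_{u ∈ S, f⁽ʲ⁺¹⁾ u = 0, f⁽ʲ⁾ u ≠ 0, Im u > 0} ord(u)·Im u²` (the population W1 counts; `finsum` reads `0` on an infinite support, which a legal frame
never has). -/
noncomputable def childEnergy (f : ℂ → ℂ) (j : ℕ) (S : Set ℂ) : ℝ :=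
  ∑ᶠ u ∈ {u : ℂ | (iteratedDeriv (j + 1) f u = 0 ∧ iteratedDeriv j f u ≠ 0 ∧ u ∈ S) ∧ 0 < u.im},
    (analyticOrderNatAt (iteratedDeriv (j + 1) f) u : ℝ) * u.im ^ 2

/-- §1 the STATE FIELD MODULUS `κ_v := ‖tiltAt f j v‖` — the field the other zeros (partner `v̄` excluded) and the exponential factor exert AT the state
(`RhW08.BurgersRate.tiltAt` = `newtonK + i/(2·Im v)`; the column's κ_book). -/
noncomputable def stateKappa (f : ℂ → ℂ) (j : ℕ) (v : ℂ) : ℝ := ‖tiltAt f j v‖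

/-! ## §2 The law -/

/-- (LAW T′ = C′ — TOUCHED-LEVEL DISSIPATION ON APPROACH LEVELS; typed, OPEN; dimensionless; parameters `c` = dissipation constant, `κ₀` = floor)
on a legal frame, at a CHARGED APPROACH level `j` (`ApproachLevelQ`: neither far nor consumption — v2's added binder) with lowest band state `v` touched by a strictly taller zero `z` (`Touches`), the pair atomic (`AtomicPair`) and the state field above
the floor (`κ₀ ≤ Im v·κ_v`): the pair energy `Im v² + Im z²` exceeds the energy of the upper children of `f⁽ʲ⁺¹⁾` off `Z(f⁽ʲ⁾)` in `Ū = D̄_v ∪ D̄_z`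
(multiplicity-weighted) by at least `c/κ_v²`.  Column (instr-1): κ_book²·ΔE on touched charged levels by regime of κ·Im v; kill `> −c` above the floor. -/
def TouchedDissipationLawQ (c κ₀ : ℝ) : Prop :=
  ∀ (η : ℝ) (f : ℂ → ℂ) (x₀ s hmax R Hs : ℝ) (B : ℕ), EngineHyps5 2 η f x₀ s hmax R Hs B →
    ∀ (j : ℕ) (v z : ℂ), Charged (PTrkSQ PBot) StTrkDQ ReadyR2 η f x₀ s hmax R Hs B j → ApproachLevelQ η f x₀ s hmax R Hs B j →
      IsLowest StTrkDQ η f x₀ s hmax R Hs B j v → Touches f j v z → AtomicPair f j v z →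
      κ₀ ≤ v.im * stateKappa f j v →
      c ≤ ((v.im ^ 2 + z.im ^ 2) - childEnergy f j (pairUnion v z)) * stateKappa f j v ^ 2

/-- (LAW T-∃ — the constants EXISTENTIAL; typing checklist (iv)) some admissible `(c, κ₀)` — `1 ≤ c` («at least one isolated pair's rate») and
`0 < κ₀` — satisfies `TouchedDissipationLawQ c κ₀`.  Record candidates against the column: `(1, 2)`, `(1, 3)`; the first-order asymptote is `c = 3`. -/
def TouchedDissipationLawQEx : Prop :=
  ∃ c κ₀ : ℝ, 1 ≤ c ∧ 0 < κ₀ ∧ TouchedDissipationLawQ c κ₀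


/-! ## §2b (v3-OPTION) The law in the books' `s`-currency -/

/-- (LAW T″ — `s`-CURRENCY FORM, v3-option) same population as `TouchedDissipationLawQ` (charged APPROACH level, lowest band state `v` touched by a
strictly taller `z`, the pair atomic, the state field above the floor `κ₀ ≤ Im v·κ_v`); conclusion directly in the books' currency: **the pair energy
drops by at least `c·(s/η)²`**, written multiplied out `c·s² ≤ η²·((Im v² + Im z²) − childEnergy(Ū))`.  This is what the β potential consumes; no state
cap is needed downstream.  Benches: X″ := ΔE·(η/s)² ≥ 3.96 on instr-1's 22 886 rows (from X ≥ 2.596 and κ_v·s/η ≤ 0.81); 5.1–6.8 on the WΓ family. -/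
def TouchedDissipationLawSQ (c κ₀ : ℝ) : Prop :=
  ∀ (η : ℝ) (f : ℂ → ℂ) (x₀ s hmax R Hs : ℝ) (B : ℕ), EngineHyps5 2 η f x₀ s hmax R Hs B →
    ∀ (j : ℕ) (v z : ℂ), Charged (PTrkSQ PBot) StTrkDQ ReadyR2 η f x₀ s hmax R Hs B j → ApproachLevelQ η f x₀ s hmax R Hs B j →
      IsLowest StTrkDQ η f x₀ s hmax R Hs B j v → Touches f j v z → AtomicPair f j v z →
      κ₀ ≤ v.im * stateKappa f j v →
      c * s ^ 2 ≤ η ^ 2 * ((v.im ^ 2 + z.im ^ 2) - childEnergy f j (pairUnion v z))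

/-- (LAW T″-∃, v3-option) some admissible `(c, κ₀)`, `1 ≤ c`, `0 < κ₀`, satisfies `TouchedDissipationLawSQ c κ₀` (record instance to aim at: `(3/2, 3)`). -/
def TouchedDissipationLawSQEx : Prop :=
  ∃ c κ₀ : ℝ, 1 ≤ c ∧ 0 < κ₀ ∧ TouchedDissipationLawSQ c κ₀

/-! ## §G0′ the `s`-currency algebra (statement file §3, verbatim) -/

/-- (K) §3 THE `s`-CURRENCY READING (pure algebra): a dimensionless drop `c ≤ ΔE·κ²` with `0 < c`, `0 ≤ κ` under a cap `κ ≤ λ·(η/s)` gives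
`c·s² ≤ λ²·η²·ΔE` — with `λ = 1 + θ` this is the form the books' potential consumes («per touched level `E` loses ≥ c·s²/((1+θ)η)²»). -/
theorem sCurrency_of_dimensionless {c κ lam η s ΔE : ℝ} (hc : 0 < c) (hs : 0 < s) (hκ : 0 ≤ κ)
    (hdrop : c ≤ ΔE * κ ^ 2) (hcap : κ ≤ lam * (η / s)) : c * s ^ 2 ≤ lam ^ 2 * η ^ 2 * ΔE := by
  have hΔ : 0 ≤ ΔE := by
    by_contra hneg
    push Not at hneg
    nlinarith [sq_nonneg κ]
  have hcap2 : κ ^ 2 ≤ (lam * (η / s)) ^ 2 := pow_le_pow_left₀ hκ hcap 2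
  have h1 : c * s ^ 2 ≤ ΔE * κ ^ 2 * s ^ 2 := mul_le_mul_of_nonneg_right hdrop (sq_nonneg s)
  have h2 : ΔE * κ ^ 2 * s ^ 2 ≤ ΔE * (lam * (η / s)) ^ 2 * s ^ 2 :=
    mul_le_mul_of_nonneg_right (mul_le_mul_of_nonneg_left hcap2 hΔ) (sq_nonneg s)
  have h3 : ΔE * (lam * (η / s)) ^ 2 * s ^ 2 = lam ^ 2 * η ^ 2 * ΔE := by
    field_simp
  rw [h3] at h2
  exact h1.trans h2


/-! ## §G1 Level objects of the glue -/

/-- §G1 the TOUCHER HEIGHT of level `j`: `sSup` of `Im z` over the touchers `z` of the lowest band states (`sSup ∅ = 0`: an untouched level reads `0`). -/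
noncomputable def touchH : LevelMeter := fun η f x₀ s hmax R Hs B j =>
  sSup ((fun z : ℂ => z.im) '' {z : ℂ | ∃ v : ℂ, IsLowest StTrkDQ η f x₀ s hmax R Hs B j v ∧ Touches f j v z})

/-- §G1 the PAIR ENERGY meter `E j := lowH j² + touchH j²`. -/
noncomputable def touchEnergyQ : LevelMeter := fun η f x₀ s hmax R Hs B j =>
  lowH StTrkDQ η f x₀ s hmax R Hs B j ^ 2 + touchH η f x₀ s hmax R Hs B j ^ 2

/-- §G1 the PAID β CLASS: approach levels whose lowest band state is touched by a strictly taller zero, the pair atomic, the state field above the floor. -/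
def BetaLevelQ (κ₀ : ℝ) : LevelClass := fun η f x₀ s hmax R Hs B j =>
  ApproachLevelQ η f x₀ s hmax R Hs B j ∧
    ∃ v z : ℂ, IsLowest StTrkDQ η f x₀ s hmax R Hs B j v ∧ Touches f j v z ∧ AtomicPair f j v z ∧ κ₀ ≤ v.im * stateKappa f j v

/-- §G1 the β POTENTIAL `Φ k := (1+θ)²η²/(c·s²) · E k`. -/
noncomputable def betaPotentialQ (θ c : ℝ) : LevelMeter := fun η f x₀ s hmax R Hs B k =>
  (1 + θ) ^ 2 * η ^ 2 / (c * s ^ 2) * touchEnergyQ η f x₀ s hmax R Hs B k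

/-- §G1 the RISE METER of the β potential: every upward move of `Φ` plus every upward move of the lowest height, in the books' currencies
(`max (Φ(k+1) − Φ k) 0 + 4·max (−dropQ k) 0 / s`; over-booking only enlarges the allowance). -/
noncomputable def touchRiseQ (θ c : ℝ) : LevelMeter := fun η f x₀ s hmax R Hs B k =>
  max (betaPotentialQ θ c η f x₀ s hmax R Hs B (k + 1) - betaPotentialQ θ c η f x₀ s hmax R Hs B k) 0
    + 4 * max (-dropQ η f x₀ s hmax R Hs B k) 0 / s

/-- §G1 the β PURSE `(1+θ)²·(Hs/s)²/(2c)` — a share of the purse's existing `(Hs/s)²` term. -/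
noncomputable def betaPurseQ (θ c : ℝ) : Budget := fun _η _f _x₀ s _hmax _R Hs _B => (1 + θ) ^ 2 * (Hs / s) ^ 2 / (2 * c)

/-! ## §G2 The named gaps (typed, OPEN — hypotheses of the glue, not sorries) -/

/-- (Γ1 — NOT USED in this v3-option; candidate negative «WΓ», see header) STATE CAP on β-levels: `κ_v ≤ (1+θ)·η/s`. Kept for reference only. -/
def StateCapLawQ (θ κ₀ : ℝ) : Prop :=
  ∀ (η : ℝ) (f : ℂ → ℂ) (x₀ s hmax R Hs : ℝ) (B : ℕ), EngineHyps5 2 η f x₀ s hmax R Hs B →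
    ∀ (j : ℕ) (v z : ℂ), Charged (PTrkSQ PBot) StTrkDQ ReadyR2 η f x₀ s hmax R Hs B j → ApproachLevelQ η f x₀ s hmax R Hs B j →
      IsLowest StTrkDQ η f x₀ s hmax R Hs B j v → Touches f j v z → AtomicPair f j v z → κ₀ ≤ v.im * stateKappa f j v →
      stateKappa f j v ≤ (1 + θ) * (η / s)

/-- (Γ2, OPEN) PERSISTENCE on β-levels: the next level's pair energy is at most the energy of the children in `Ū`. -/
def PersistenceLawQ (κ₀ : ℝ) : Prop :=
  ∀ (η : ℝ) (f : ℂ → ℂ) (x₀ s hmax R Hs : ℝ) (B : ℕ), EngineHyps5 2 η f x₀ s hmax R Hs B →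
    ∀ (j : ℕ) (v z : ℂ), Charged (PTrkSQ PBot) StTrkDQ ReadyR2 η f x₀ s hmax R Hs B j → ApproachLevelQ η f x₀ s hmax R Hs B j →
      IsLowest StTrkDQ η f x₀ s hmax R Hs B j v → Touches f j v z → AtomicPair f j v z → κ₀ ≤ v.im * stateKappa f j v →
      touchEnergyQ η f x₀ s hmax R Hs B (j + 1) ≤ childEnergy f j (pairUnion v z)

/-- (Γ3, OPEN as to SIZE) RISE ALLOWANCE: before the horizon the booked rises of the β potential stay within `aT` (shape of `EnergyRiseLawQ`). -/
def TouchRiseLawQ (θ c : ℝ) (aT : Budget) : Prop :=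
  ∀ (η : ℝ) (f : ℂ → ℂ) (x₀ s hmax R Hs : ℝ) (B : ℕ), EngineHyps5 2 η f x₀ s hmax R Hs B →
    ∀ k : ℕ, Charged (PTrkSQ PBot) StTrkDQ ReadyR2 η f x₀ s hmax R Hs B k →
      prefixSumQ (touchRiseQ θ c) η f x₀ s hmax R Hs B (k + 1) ≤ aT η f x₀ s hmax R Hs B

/-! ## §G3 Bookkeeping of the level objects (K) -/

/-- (K) the lowest height of a legal frame's level is at most `Hs` (strip heredity; `0` on an empty level). -/
theorem lowH_le_Hs {η : ℝ} {f : ℂ → ℂ} {x₀ s hmax R Hs : ℝ} {B : ℕ} (hE : EngineHyps5 2 η f x₀ s hmax R Hs B) (k : ℕ) :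
    lowH StTrkDQ η f x₀ s hmax R Hs B k ≤ Hs := by
  have hHs : 0 ≤ Hs := hE.2.2.2.2.2.2.2.1
  by_cases hex : ∃ u : ℂ, StTrkDQ η f x₀ s hmax R Hs B k u
  · obtain ⟨u, hu⟩ := hex
    exact (lowH_le hu).trans (RhW08.Column.abs_im_le_of_level hE hu.1 hu.2.1)
  · have hset : {u : ℂ | StTrkDQ η f x₀ s hmax R Hs B k u} = ∅ := by
      ext u
      simp only [Set.mem_setOf_eq, Set.mem_empty_iff_false, iff_false]
      exact fun hu => hex ⟨u, hu⟩
    show sInf ((fun u : ℂ => |u.im|) '' {u : ℂ | StTrkDQ η f x₀ s hmax R Hs B k u}) ≤ Hs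
    rw [hset, Set.image_empty, Real.sInf_empty]
    exact hHs

/-- (K) the toucher height is non-negative. -/
theorem touchH_nonneg (η : ℝ) (f : ℂ → ℂ) (x₀ s hmax R Hs : ℝ) (B k : ℕ) : 0 ≤ touchH η f x₀ s hmax R Hs B k := by
  refine Real.sSup_nonneg ?_
  rintro x ⟨z, ⟨v, hlow, ht⟩, rfl⟩
  have hv0 : 0 < v.im := hlow.1.2.2.1
  exact (hv0.trans ht.2.1).le

/-- (K) the toucher height of a legal frame's level is at most `Hs`. -/
theorem touchH_le_Hs {η : ℝ} {f : ℂ → ℂ} {x₀ s hmax R Hs : ℝ} {B : ℕ} (hE : EngineHyps5 2 η f x₀ s hmax R Hs B) (k : ℕ) :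
    touchH η f x₀ s hmax R Hs B k ≤ Hs := by
  have hHs : 0 ≤ Hs := hE.2.2.2.2.2.2.2.1
  refine Real.sSup_le ?_ hHs
  rintro x ⟨z, ⟨v, hlow, ht⟩, rfl⟩
  exact (le_abs_self _).trans (RhW08.Column.abs_im_le_of_level hE hlow.1.1 ht.1)

/-- (K) the pair energy is non-negative and at most `2·Hs²` on a legal frame. -/
theorem touchEnergyQ_nonneg (η : ℝ) (f : ℂ → ℂ) (x₀ s hmax R Hs : ℝ) (B k : ℕ) : 0 ≤ touchEnergyQ η f x₀ s hmax R Hs B k := by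
  unfold touchEnergyQ; positivity

/-- (K) `E k ≤ 2·Hs²` on a legal frame. -/
theorem touchEnergyQ_le {η : ℝ} {f : ℂ → ℂ} {x₀ s hmax R Hs : ℝ} {B : ℕ} (hE : EngineHyps5 2 η f x₀ s hmax R Hs B) (k : ℕ) :
    touchEnergyQ η f x₀ s hmax R Hs B k ≤ 2 * Hs ^ 2 := by
  have h1 : lowH StTrkDQ η f x₀ s hmax R Hs B k ^ 2 ≤ Hs ^ 2 := pow_le_pow_left₀ lowH_nonneg' (lowH_le_Hs hE k) 2
  have h2 : touchH η f x₀ s hmax R Hs B k ^ 2 ≤ Hs ^ 2 :=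
    pow_le_pow_left₀ (touchH_nonneg η f x₀ s hmax R Hs B k) (touchH_le_Hs hE k) 2
  unfold touchEnergyQ; linarith

/-- (K) at a level with lowest band state `v` touched by `z`, the pair's energy is below the meter: `Im v² + Im z² ≤ E k`. -/
theorem pair_le_touchEnergyQ {η : ℝ} {f : ℂ → ℂ} {x₀ s hmax R Hs : ℝ} {B k : ℕ} {v z : ℂ} (hE : EngineHyps5 2 η f x₀ s hmax R Hs B)
    (hlow : IsLowest StTrkDQ η f x₀ s hmax R Hs B k v) (ht : Touches f k v z) :
    v.im ^ 2 + z.im ^ 2 ≤ touchEnergyQ η f x₀ s hmax R Hs B k := by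
  have hL : lowH StTrkDQ η f x₀ s hmax R Hs B k = v.im := lowH_eq_of_isLowest hlow
  have hbdd : BddAbove ((fun z : ℂ => z.im) '' {z : ℂ | ∃ v : ℂ, IsLowest StTrkDQ η f x₀ s hmax R Hs B k v ∧ Touches f k v z}) := by
    refine ⟨Hs, ?_⟩
    rintro x ⟨z', ⟨v', hlow', ht'⟩, rfl⟩
    exact (le_abs_self _).trans (RhW08.Column.abs_im_le_of_level hE hlow'.1.1 ht'.1)
  have hz : z.im ≤ touchH η f x₀ s hmax R Hs B k := le_csSup hbdd ⟨z, ⟨v, hlow, ht⟩, rfl⟩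
  have hz0 : 0 ≤ z.im := (hlow.1.2.2.1.trans ht.2.1).le
  have hz2 : z.im ^ 2 ≤ touchH η f x₀ s hmax R Hs B k ^ 2 := pow_le_pow_left₀ hz0 hz 2
  unfold touchEnergyQ; rw [hL]; linarith

/-- (K) per-frame reading of the β purse. -/
theorem betaPurseQ_apply (θ c η : ℝ) (f : ℂ → ℂ) (x₀ s hmax R Hs : ℝ) (B : ℕ) :
    betaPurseQ θ c η f x₀ s hmax R Hs B = (1 + θ) ^ 2 * (Hs / s) ^ 2 / (2 * c) := rfl

/-- (K) THE DIRECTOR'S NUMBER: with the first-order constant `c = 3` and `0 ≤ θ ≤ 1/200` the β purse is `(1/6)(1+θ)²(Hs/s)² ≤ 0.17·(Hs/s)²`. -/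
theorem betaPurseQ_three_le {θ : ℝ} (hθ0 : 0 ≤ θ) (hθ : θ ≤ 1 / 200) (η : ℝ) (f : ℂ → ℂ) (x₀ s hmax R Hs : ℝ) (B : ℕ) :
    betaPurseQ θ 3 η f x₀ s hmax R Hs B ≤ 17 / 100 * (Hs / s) ^ 2 := by
  rw [betaPurseQ_apply]
  have h1 : (1 + θ) ^ 2 ≤ (201 / 200) ^ 2 := pow_le_pow_left₀ (by linarith) (by linarith) 2
  nlinarith [sq_nonneg (Hs / s)]

/-- (K) AT THE CONSTANTS OF RECORD `(c, κ₀) = (3/2, 3)` (director (CA615), instr-1 TPRICE 7d831b67): with `0 ≤ θ ≤ 1/200` the β purse is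
`(1+θ)²(Hs/s)²/3 ≤ 0.3367·(Hs/s)²` (`(201/200)²/3 = 0.336675`). -/
theorem betaPurseQ_threeHalves_le {θ : ℝ} (hθ0 : 0 ≤ θ) (hθ : θ ≤ 1 / 200) (η : ℝ) (f : ℂ → ℂ) (x₀ s hmax R Hs : ℝ) (B : ℕ) :
    betaPurseQ θ (3 / 2) η f x₀ s hmax R Hs B ≤ 3367 / 10000 * (Hs / s) ^ 2 := by
  rw [betaPurseQ_apply]
  have h1 : (1 + θ) ^ 2 ≤ (201 / 200) ^ 2 := pow_le_pow_left₀ (by linarith) (by linarith) 2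
  nlinarith [sq_nonneg (Hs / s)]

/-- (K) with the admissible floor `c = 1` and `0 ≤ θ ≤ 1/200` the β purse is `≤ 0.51·(Hs/s)²` — still inside the single `(Hs/s)²` term next to F's `5/16`. -/
theorem betaPurseQ_one_le {θ : ℝ} (hθ0 : 0 ≤ θ) (hθ : θ ≤ 1 / 200) (η : ℝ) (f : ℂ → ℂ) (x₀ s hmax R Hs : ℝ) (B : ℕ) :
    betaPurseQ θ 1 η f x₀ s hmax R Hs B ≤ 51 / 100 * (Hs / s) ^ 2 := by
  rw [betaPurseQ_apply]
  have h1 : (1 + θ) ^ 2 ≤ (201 / 200) ^ 2 := pow_le_pow_left₀ (by linarith) (by linarith) 2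
  nlinarith [sq_nonneg (Hs / s)]


/-! ## §G4 ★ The β class law from (T) + (Γ1) + (Γ2) + (Γ3) — PROVED -/

open Classical in
set_option maxHeartbeats 800000 in
/-- ★★ (K, v3-OPTION) **(T″) + PERSISTENCE + RISE ALLOWANCE ⟹ the β CLASS LAW — NO STATE CAP** with allowance `betaPurseQ θ c + aT`, by the books' socket
`classLawQ_of_potential_rises` with `Φ = betaPotentialQ θ c` and rise meter `touchRiseQ θ c`: a charged β-level lowers `Φ` by ≥ 1
(`sCurrency_of_dimensionless`), its signed height move and every other move of `Φ` are booked. -/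
theorem betaClassLaw_of_TS {θ c κ₀ : ℝ} {aT : Budget} (hθ : 0 ≤ θ) (hc : 0 < c) (hT : TouchedDissipationLawSQ c κ₀)
    (hper : PersistenceLawQ κ₀) (hrise : TouchRiseLawQ θ c aT) :
    ClassLawQ (BetaLevelQ κ₀) (addBudget (betaPurseQ θ c) aT) := by
  refine classLawQ_of_potential_rises (betaPotentialQ θ c) (touchRiseQ θ c) ?_
  intro η f x₀ s hmax R Hs B hE
  have hs : 0 < s := hE.2.2.2.1
  have hη0 : 0 ≤ η := hE.2.2.2.2.2.2.2.2.2.2.2.2.2.1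
  have hη1 : 2 * η ≤ 1 := hE.2.2.2.2.2.2.2.2.2.2.2.2.2.2.1
  have hL0 : 0 ≤ (1 + θ) ^ 2 * η ^ 2 / (c * s ^ 2) := by positivity
  refine ⟨fun k => ?_, ?_, fun k hk => hrise η f x₀ s hmax R Hs B hE k hk, fun k _ => ?_⟩
  · -- `Φ ≥ 0`
    exact mul_nonneg hL0 (touchEnergyQ_nonneg η f x₀ s hmax R Hs B k)
  · -- `Φ 0 ≤ (1+θ)²η²·2Hs²/(c s²) ≤ (1+θ)²(Hs/s)²/(2c)`
    have hE0 := touchEnergyQ_le hE 0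
    have hη2 : η ^ 2 ≤ 1 / 4 := by nlinarith
    have hA : 0 ≤ (1 + θ) ^ 2 * (2 * Hs ^ 2) / (c * s ^ 2) := by positivity
    show (1 + θ) ^ 2 * η ^ 2 / (c * s ^ 2) * touchEnergyQ η f x₀ s hmax R Hs B 0 ≤ (1 + θ) ^ 2 * (Hs / s) ^ 2 / (2 * c)
    calc (1 + θ) ^ 2 * η ^ 2 / (c * s ^ 2) * touchEnergyQ η f x₀ s hmax R Hs B 0
        ≤ (1 + θ) ^ 2 * η ^ 2 / (c * s ^ 2) * (2 * Hs ^ 2) := mul_le_mul_of_nonneg_left hE0 hL0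
      _ = (1 + θ) ^ 2 * (2 * Hs ^ 2) / (c * s ^ 2) * η ^ 2 := by ring
      _ ≤ (1 + θ) ^ 2 * (2 * Hs ^ 2) / (c * s ^ 2) * (1 / 4) := mul_le_mul_of_nonneg_left hη2 hA
      _ = (1 + θ) ^ 2 * (Hs / s) ^ 2 / (2 * c) := by field_simp; ring
  · -- the step across level `k`
    have hdrop : -(4 * dropQ η f x₀ s hmax R Hs B k / s) ≤ 4 * max (-dropQ η f x₀ s hmax R Hs B k) 0 / s := by
      rw [← neg_div, ← mul_neg]
      exact div_le_div_of_nonneg_right (mul_le_mul_of_nonneg_left (le_max_left _ _) (by norm_num)) hs.le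
    have hm0 : 0 ≤ max (betaPotentialQ θ c η f x₀ s hmax R Hs B (k + 1) - betaPotentialQ θ c η f x₀ s hmax R Hs B k) 0 :=
      le_max_right _ _
    have hm1 : betaPotentialQ θ c η f x₀ s hmax R Hs B (k + 1) - betaPotentialQ θ c η f x₀ s hmax R Hs B k
        ≤ max (betaPotentialQ θ c η f x₀ s hmax R Hs B (k + 1) - betaPotentialQ θ c η f x₀ s hmax R Hs B k) 0 := le_max_left _ _
    have hd0 : 0 ≤ 4 * max (-dropQ η f x₀ s hmax R Hs B k) 0 / s := by positivity
    by_cases hj : Charged (PTrkSQ PBot) StTrkDQ ReadyR2 η f x₀ s hmax R Hs B k ∧ BetaLevelQ κ₀ η f x₀ s hmax R Hs B k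
    · rw [if_pos hj]
      obtain ⟨hch, happ, v, z, hlow, ht, ha, hfl⟩ := hj
      have hsq := hT η f x₀ s hmax R Hs B hE k v z hch happ hlow ht ha hfl
      have hΔ0 : 0 ≤ (v.im ^ 2 + z.im ^ 2) - childEnergy f k (pairUnion v z) := by
        by_contra hneg
        push Not at hneg
        nlinarith [sq_nonneg η, mul_pos hc (pow_pos hs 2)]
      have h1θ : η ^ 2 ≤ (1 + θ) ^ 2 * η ^ 2 := by nlinarith [sq_nonneg η, sq_nonneg θ]
      have hsc : c * s ^ 2 ≤ (1 + θ) ^ 2 * η ^ 2 * ((v.im ^ 2 + z.im ^ 2) - childEnergy f k (pairUnion v z)) :=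
        hsq.trans (mul_le_mul_of_nonneg_right h1θ hΔ0)
      have hpk := pair_le_touchEnergyQ hE hlow ht
      have hp1 := hper η f x₀ s hmax R Hs B hE k v z hch happ hlow ht ha hfl
      -- the potential pays at least one unit
      have hunit : 1 ≤ (1 + θ) ^ 2 * η ^ 2 / (c * s ^ 2) * ((v.im ^ 2 + z.im ^ 2) - childEnergy f k (pairUnion v z)) := by
        rw [div_mul_eq_mul_div, le_div_iff₀ (by positivity), one_mul]
        linarith
      have hmono : (1 + θ) ^ 2 * η ^ 2 / (c * s ^ 2) * ((v.im ^ 2 + z.im ^ 2) - childEnergy f k (pairUnion v z))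
          ≤ (1 + θ) ^ 2 * η ^ 2 / (c * s ^ 2) * (touchEnergyQ η f x₀ s hmax R Hs B k - touchEnergyQ η f x₀ s hmax R Hs B (k + 1)) :=
        mul_le_mul_of_nonneg_left (by linarith) hL0
      have hpay : 1 ≤ betaPotentialQ θ c η f x₀ s hmax R Hs B k - betaPotentialQ θ c η f x₀ s hmax R Hs B (k + 1) := by
        show 1 ≤ (1 + θ) ^ 2 * η ^ 2 / (c * s ^ 2) * touchEnergyQ η f x₀ s hmax R Hs B k
          - (1 + θ) ^ 2 * η ^ 2 / (c * s ^ 2) * touchEnergyQ η f x₀ s hmax R Hs B (k + 1)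
        rw [← mul_sub]
        exact hunit.trans hmono
      show betaPotentialQ θ c η f x₀ s hmax R Hs B (k + 1) + (1 - 4 * dropQ η f x₀ s hmax R Hs B k / s)
        ≤ betaPotentialQ θ c η f x₀ s hmax R Hs B k
          + (max (betaPotentialQ θ c η f x₀ s hmax R Hs B (k + 1) - betaPotentialQ θ c η f x₀ s hmax R Hs B k) 0
            + 4 * max (-dropQ η f x₀ s hmax R Hs B k) 0 / s)
      linarith
    · rw [if_neg hj, add_zero]
      show betaPotentialQ θ c η f x₀ s hmax R Hs B (k + 1)
        ≤ betaPotentialQ θ c η f x₀ s hmax R Hs B k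
          + (max (betaPotentialQ θ c η f x₀ s hmax R Hs B (k + 1) - betaPotentialQ θ c η f x₀ s hmax R Hs B k) 0
            + 4 * max (-dropQ η f x₀ s hmax R Hs B k) 0 / s)
      linarith

/-! ## §G5 ★★ Composition to ★A's literal type -/

/-- (K) class laws are MONOTONE in the allowance (on legal frames). -/
theorem classLawQ_mono {𝓚 : LevelClass} {a a' : Budget} (h : ClassLawQ 𝓚 a)
    (hle : ∀ (η : ℝ) (f : ℂ → ℂ) (x₀ s hmax R Hs : ℝ) (B : ℕ), EngineHyps5 2 η f x₀ s hmax R Hs B →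
      a η f x₀ s hmax R Hs B ≤ a' η f x₀ s hmax R Hs B) : ClassLawQ 𝓚 a' :=
  fun η f x₀ s hmax R Hs B hE k hk => (h η f x₀ s hmax R Hs B hE k hk).trans (hle η f x₀ s hmax R Hs B hE)

/-- (K) ★A's class reassembled: a β class law and a law for the REST of the approach class give `ApproachAllowanceQ (aβ + aRest)` (`classLawQ_union`). -/
theorem approachAllowanceQ_of_beta_rest {κ₀ : ℝ} {aβ aRest : Budget} (hβ : ClassLawQ (BetaLevelQ κ₀) aβ)
    (hrest : ClassLawQ (diffClass ApproachLevelQ (BetaLevelQ κ₀)) aRest) : ApproachAllowanceQ (addBudget aβ aRest) := by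
  have hU := classLawQ_union hβ hrest
  exact classLawQ_congr (fun η f x₀ s hmax R Hs B j => ⟨fun h => h.elim (fun hb => hb.1) id, fun h => Or.inr h⟩) hU

/-- ★★ (v3-OPTION, from T″ WITHOUT the state cap) (K, modulo the NAMED hypotheses) **THE GLUE**: (T) + (Γ1) CAP + (Γ2) PERSISTENCE + (Γ3) RISE ALLOWANCE + (Γ4) the rest of the approach class +
the CAPITAL FIT ⟹ `ApproachAllowanceQ (approachBudgetHalfQ riseSupQ consSupQ)` — literally the registry's `stub_approachC` conclusion; no new constant. -/
theorem approachC_of_TS {θ c κ₀ : ℝ} {aT aRest : Budget} (hθ : 0 ≤ θ) (hc : 0 < c) (hT : TouchedDissipationLawSQ c κ₀)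
    (hper : PersistenceLawQ κ₀) (hrise : TouchRiseLawQ θ c aT)
    (hrest : ClassLawQ (diffClass ApproachLevelQ (BetaLevelQ κ₀)) aRest)
    (hfit : ∀ (η : ℝ) (f : ℂ → ℂ) (x₀ s hmax R Hs : ℝ) (B : ℕ), EngineHyps5 2 η f x₀ s hmax R Hs B →
      betaPurseQ θ c η f x₀ s hmax R Hs B + aT η f x₀ s hmax R Hs B + aRest η f x₀ s hmax R Hs B
        ≤ approachBudgetHalfQ riseSupQ consSupQ η f x₀ s hmax R Hs B) :
    ApproachAllowanceQ (approachBudgetHalfQ riseSupQ consSupQ) :=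
  classLawQ_mono (approachAllowanceQ_of_beta_rest (betaClassLaw_of_TS hθ hc hT hper hrise) hrest)
    (fun η f x₀ s hmax R Hs B hE => by
      show betaPurseQ θ c η f x₀ s hmax R Hs B + aT η f x₀ s hmax R Hs B + aRest η f x₀ s hmax R Hs B ≤ _
      exact hfit η f x₀ s hmax R Hs B hE)

/-- (K) the capital fit READ per frame (`approachBudgetHalf_apply`): what the last hypothesis of `approachC_of_T` asks of the purse
`4·hmax/s + (Hs/s)² + B + 1 (+ (B+1)/2 void charge)`. -/
theorem capitalFit_iff (θ c : ℝ) (aT aRest : Budget) (η : ℝ) (f : ℂ → ℂ) (x₀ s hmax R Hs : ℝ) (B : ℕ) :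
    betaPurseQ θ c η f x₀ s hmax R Hs B + aT η f x₀ s hmax R Hs B + aRest η f x₀ s hmax R Hs B
        ≤ approachBudgetHalfQ riseSupQ consSupQ η f x₀ s hmax R Hs B ↔
      (1 + θ) ^ 2 * (Hs / s) ^ 2 / (2 * c) + aT η f x₀ s hmax R Hs B + aRest η f x₀ s hmax R Hs B
        ≤ slack0Q η f x₀ s hmax R Hs B - 5 / 4 * energyPurseQ η f x₀ s hmax R Hs B - 5 / 4 * riseSupQ η f x₀ s hmax R Hs B
          - consSupQ η f x₀ s hmax R Hs B + ((B : ℝ) + 1) / 2 := by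
  rw [approachBudgetHalf_apply, betaPurseQ_apply]

end RhW08.TouchedDissipation
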